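import Summits.Ventures.PercRepro.Decide
import Summits.Ventures.PercRepro.SMC

/-!
# The `k = 3` partition law in one kernel pass

For kernel refutations of row candidates (`C013Refutation`, `E8Refutation`) the five rows of the
partition law of three marked vertices are needed as exact integers.  Deciding five separate
`probNat` values re-decides connectivity of every configuration five times; here the law is
computed in ONE pass: `law3NatTuple` sums, over all configurations, the 5-tuple carrying the
integer weight in the slot of the configuration's cell (`cell3D`), so the kernel decides
connectivity once per configuration.  `law3NatTuple_eq` identifies the tuple with the five
`probNat` row values and `law3_of_law3NatTuple` turns one kernel-decided tuple into the five real
row probabilities `G.law3` of `SMC.lean` (the form every row candidate is stated in).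
-/

namespace PercRepro

namespace MultiGraph

variable {V E : Type*} (G : MultiGraph V E) [DecidableEq V] [Fintype V] [Fintype E]

/-- Computable cell of `ω` for the marked vertices `a, b, c`, in the engine's row order
`0 = abc`, `1 = ab|c`, `2 = ac|b`, `3 = bc|a`, `4 = a|b|c` (decidable connectivity). -/
def cell3D (a b c : V) (ω : Config E) : Fin 5 :=
  if G.Conn ω a b ∧ G.Conn ω b c then 0 else if G.Conn ω a b then 1 else if G.Conn ω a c then 2
    else if G.Conn ω b c then 3 else 4

omit [DecidableEq V] [Fintype V] [Fintype E] in
/-- The cells are the engine rows: `cell3D ω = s` iff `ω` lies in the partition row `rgs3 s`. -/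
theorem cell3D_eq_iff_mem_partitionEvent [DecidableEq V] [Fintype V] [Fintype E] (a b c : V)
    (ω : Config E) (s : Fin 5) :
    G.cell3D a b c ω = s ↔ ω ∈ G.partitionEvent ![a, b, c] (rgs3 s) := by
  have i1 : G.Conn ω a b → (G.Conn ω a c ↔ G.Conn ω b c) :=
    fun h => ⟨fun h' => h.symm.trans h', fun h' => h.trans h'⟩
  have i2 : G.Conn ω a c → (G.Conn ω a b ↔ G.Conn ω b c) :=
    fun h => ⟨fun h' => h'.symm.trans h, fun h' => h.trans h'.symm⟩
  have i3 : G.Conn ω b c → (G.Conn ω a b ↔ G.Conn ω a c) :=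
    fun h => ⟨fun h' => h'.trans h, fun h' => h'.trans h.symm⟩
  have sab : G.Conn ω b a ↔ G.Conn ω a b := conn_comm
  have sac : G.Conn ω c a ↔ G.Conn ω a c := conn_comm
  have sbc : G.Conn ω c b ↔ G.Conn ω b c := conn_comm
  have ra : G.Conn ω a a := Conn.refl G ω a
  have rb : G.Conn ω b b := Conn.refl G ω b
  have rc : G.Conn ω c c := Conn.refl G ω c
  simp only [partitionEvent, Set.mem_setOf_eq, Fin.forall_fin_succ,
    Fin.succ_zero_eq_one, Fin.succ_one_eq_two, Matrix.cons_val_zero, Matrix.cons_val_one,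
    Matrix.cons_val_two, Matrix.head_cons, Matrix.tail_cons, rgs3]
  unfold cell3D
  fin_cases s <;> simp [Matrix.cons_val] <;> split_ifs <;> simp_all

/-- The 5-tuple with the weight `w` in slot `s`. -/
def rowTuple (s : Fin 5) (w : ℕ) : ℕ × ℕ × ℕ × ℕ × ℕ :=
  match s with
  | 0 => (w, 0, 0, 0, 0)
  | 1 => (0, w, 0, 0, 0)
  | 2 => (0, 0, w, 0, 0)
  | 3 => (0, 0, 0, w, 0)
  | 4 => (0, 0, 0, 0, w)

omit [DecidableEq V] [Fintype V] [Fintype E] in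
/-- Slot `0` of `rowTuple`. -/
theorem rowTuple_0 (s : Fin 5) (w : ℕ) : (rowTuple s w).1 = if s = 0 then w else 0 := by
  fin_cases s <;> rfl

omit [DecidableEq V] [Fintype V] [Fintype E] in
/-- Slot `1` of `rowTuple`. -/
theorem rowTuple_1 (s : Fin 5) (w : ℕ) : (rowTuple s w).2.1 = if s = 1 then w else 0 := by
  fin_cases s <;> rfl

omit [DecidableEq V] [Fintype V] [Fintype E] in
/-- Slot `2` of `rowTuple`. -/
theorem rowTuple_2 (s : Fin 5) (w : ℕ) : (rowTuple s w).2.2.1 = if s = 2 then w else 0 := by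
  fin_cases s <;> rfl

omit [DecidableEq V] [Fintype V] [Fintype E] in
/-- Slot `3` of `rowTuple`. -/
theorem rowTuple_3 (s : Fin 5) (w : ℕ) : (rowTuple s w).2.2.2.1 = if s = 3 then w else 0 := by
  fin_cases s <;> rfl

omit [DecidableEq V] [Fintype V] [Fintype E] in
/-- Slot `4` of `rowTuple`. -/
theorem rowTuple_4 (s : Fin 5) (w : ℕ) : (rowTuple s w).2.2.2.2 = if s = 4 then w else 0 := by
  fin_cases s <;> rfl

variable [DecidableEq E]

/-- **The integer partition law in one pass**: the 5-tuple of row numerators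
`(x, y₁, y₂, y₃, z)` for the weights `num / den`, summing the weight of every configuration into
the slot of its cell (connectivity decided once per configuration). -/
def law3NatTuple (a b c : V) (num den : E → ℕ) : ℕ × ℕ × ℕ × ℕ × ℕ :=
  ∑ ω : Config E, rowTuple (G.cell3D a b c ω) (weightNat num den ω)

/-- A slot of the one-pass tuple is the `probNat` of the corresponding row. -/
theorem law3NatTuple_eq (a b c : V) (num den : E → ℕ) :
    G.law3NatTuple a b c num den =
      (probNat num den (G.partitionEvent ![a, b, c] (rgs3 0)),
       probNat num den (G.partitionEvent ![a, b, c] (rgs3 1)),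
       probNat num den (G.partitionEvent ![a, b, c] (rgs3 2)),
       probNat num den (G.partitionEvent ![a, b, c] (rgs3 3)),
       probNat num den (G.partitionEvent ![a, b, c] (rgs3 4))) := by
  have key : ∀ s : Fin 5, probNat num den (G.partitionEvent ![a, b, c] (rgs3 s)) =
      ∑ ω : Config E, if G.cell3D a b c ω = s then weightNat num den ω else 0 := by
    intro s
    unfold probNat
    rw [Finset.sum_filter]
    refine Finset.sum_congr rfl fun ω _ => ?_
    by_cases h : ω ∈ G.partitionEvent ![a, b, c] (rgs3 s)
    · rw [if_pos h, if_pos ((G.cell3D_eq_iff_mem_partitionEvent a b c ω s).2 h)]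
    · rw [if_neg h, if_neg (fun h' => h ((G.cell3D_eq_iff_mem_partitionEvent a b c ω s).1 h'))]
  unfold law3NatTuple
  rw [key 0, key 1, key 2, key 3, key 4]
  rw [Prod.ext_iff, Prod.ext_iff, Prod.ext_iff, Prod.ext_iff]
  simp only [Prod.fst_sum, Prod.snd_sum]
  refine ⟨?_, ?_, ?_, ?_, ?_⟩
  · exact Finset.sum_congr rfl fun ω _ => rowTuple_0 _ _
  · exact Finset.sum_congr rfl fun ω _ => rowTuple_1 _ _
  · exact Finset.sum_congr rfl fun ω _ => rowTuple_2 _ _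
  · exact Finset.sum_congr rfl fun ω _ => rowTuple_3 _ _
  · exact Finset.sum_congr rfl fun ω _ => rowTuple_4 _ _

/-- The `probNat` row value as a real row probability. -/
theorem law3_eq_probNat_div (num den : E → ℕ) (hab : ∀ e, num e ≤ den e)
    (hb : ∀ e, 0 < den e) (a b c : V) (s : Fin 5) :
    G.law3 (fun e => (num e : ℝ) / den e) a b c s =
      (probNat num den (G.partitionEvent ![a, b, c] (rgs3 s)) : ℝ) / ∏ e, (den e : ℝ) := by
  have h := probNat_cast num den hab hb (G.partitionEvent ![a, b, c] (rgs3 s))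
  have hpos : (0 : ℝ) < ∏ e, (den e : ℝ) :=
    Finset.prod_pos fun e _ => by exact_mod_cast hb e
  rw [eq_div_iff hpos.ne', h, mul_comm]
  rfl

/-- **From one kernel tuple to the five real rows**: if `law3NatTuple = (n₀, n₁, n₂, n₃, n₄)`,
then `law3 s = nₛ / ∏ den`. -/
theorem law3_of_law3NatTuple (num den : E → ℕ) (hab : ∀ e, num e ≤ den e)
    (hb : ∀ e, 0 < den e) (a b c : V) {n0 n1 n2 n3 n4 : ℕ}
    (h : G.law3NatTuple a b c num den = (n0, n1, n2, n3, n4)) :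
    G.law3 (fun e => (num e : ℝ) / den e) a b c 0 = n0 / ∏ e, (den e : ℝ) ∧
    G.law3 (fun e => (num e : ℝ) / den e) a b c 1 = n1 / ∏ e, (den e : ℝ) ∧
    G.law3 (fun e => (num e : ℝ) / den e) a b c 2 = n2 / ∏ e, (den e : ℝ) ∧
    G.law3 (fun e => (num e : ℝ) / den e) a b c 3 = n3 / ∏ e, (den e : ℝ) ∧
    G.law3 (fun e => (num e : ℝ) / den e) a b c 4 = n4 / ∏ e, (den e : ℝ) := by
  rw [law3NatTuple_eq] at h
  simp only [Prod.mk.injEq] at h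
  obtain ⟨h0, h1, h2, h3, h4⟩ := h
  refine ⟨?_, ?_, ?_, ?_, ?_⟩
  · rw [law3_eq_probNat_div G num den hab hb, h0]
  · rw [law3_eq_probNat_div G num den hab hb, h1]
  · rw [law3_eq_probNat_div G num den hab hb, h2]
  · rw [law3_eq_probNat_div G num den hab hb, h3]
  · rw [law3_eq_probNat_div G num den hab hb, h4]

end MultiGraph

end PercRepro
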